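import Summits.CriticalPhenomena.PercolationContinuityZ3.Theorems.PercNearOneGluingNoHeavyLowerTailSahiGridPatternCellAtoms
import Summits.CriticalPhenomena.PercolationContinuityZ3.Theorems.PercNearOneGluingNoHeavyLowerTailSahiGridPatternKernel

/-!
# `NoHeavyLowerTail` (crux stmt-CriticalPhenomena-4575), Sahi programme P1: **THE CYLINDER-CERTIFICATE CHECKER** for three-coordinate
# slots (kernel-evaluable, with soundness in every dimension)

Support file (Sahi cell, seat `prim-sahi-p1`, generation 11; `--supports stmt-CriticalPhenomena-4575`).  Executable definitions (the checker
and its computable coefficient functions) + their agreement lemmas; no `sorry`, no `native_decide`, standard axioms.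

For a threshold vector `v0` (the up-set `U v0 ⊆ [3]^3` of `…SahiGridThreeKernel`) a CERTIFICATE is a list of entries `(c, kind, params)`,
`c ∈ ℕ`, each naming an atom of `…SahiGridPatternCellAtoms` (a pair of integer matrices on `[3]^3 × [3]^3` paired with the cell statistics
`cellT`, `cellN` of `…SahiGridPatternCellForm`):
  kind `0` `[a,b]`  Harris `H[a|b]` (`cellT − cellN` at the cell pair `(pnt a, pnt b)`);
  kind `1`/`2` `v`  good-slot atoms `Σ β_{U v}·cellT` / `Σ β_{U v}·cellN` (PatternPos 3, KERNEL: `sStarD_three_nonneg`; `β` in closed form `ppL`);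
  kind `3`/`4` `[a,lo,hi]` Kleitman column of `U v0` around the cell `pnt a` on the `C` side times the dual-cone generator `(lo,hi)` (`gv`: point
  evaluation if `lo = hi`, else upward difference) on the `B` side;  kind `5`/`6` `[a,lo,hi]` the same with the sides exchanged;
  kind `7`/`8` `[lo,hi,lo',hi']` products of two generators.
`cylCheck v0 L cert` verifies `L > 0`, that `U v0` (and every `U v` used) is an up-set, generator validity, and the matrix identity
`L·(tgtT, tgtN) = Σ c·atom` entrywise over the `2·729` cell pairs (rows pruned by `rowNZ` before the inner loop, as in `sliceCheck`).  Soundness (`cylGood_of_cylCheck`: a passing certificate proves `sStarD (cylSet (U v0)) B C ≥ 0` for EVERY `n` and all up-sets `B, C`) is in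
`…SahiGridPatternCellSound`; the certificates (LP over these atoms + exact reconstruction; seat folder code/cyllp2.py, kit j135783/j135999) are
replayed in `…SahiGridPatternCyl3_*`. [this work]
-/

namespace Summit.CriticalPhenomena.PercolationContinuityZ3.Theorems.SahiGridPattern

open Finset SahiGrid3
open scoped BigOperators FinsetFamily

variable {n k : ℕ}

/-! ### Computable versions of the coefficient functions on the small cube `P3 = [3]^3` -/

/-- `1_{U v}` via the Boolean membership test. [this work] -/
def indUP (v : List ℕ) (p : P3) : ℤ := if memUP v p = true then 1 else 0

/-- `indUP` is the indicator of `U v`. [this work] -/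
theorem indUP_eq (v : List ℕ) (p : P3) : indUP v p = ind (U v) p := by
  unfold indUP ind
  by_cases h : p ∈ U v
  · rw [if_pos h, if_pos ((mem_U_iff v p).1 h)]
  · rw [if_neg h, if_neg (fun h' => h ((mem_U_iff v p).2 h'))]

/-- Computable Kleitman coefficients for `U v`. [this work] -/
def klC (v : List ℕ) (q r : P3) : ℤ := if TotDist r q = true then indUP v r - indUP v (thirdPt r q) else 0

/-- `klC v = klCoef (U v)`. [this work] -/
theorem klC_eq (v : List ℕ) (q r : P3) : klC v q r = klCoef (U v) q r := by
  unfold klC klCoef; rw [indUP_eq, indUP_eq]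

/-- Computable `λ_{U v}`. [this work] -/
def lamL (v : List ℕ) (q : P3) : ℤ :=
  2 * 8 * indUP v q - ((P3list.filter fun p => memUP v p && TotDist p q).length : ℤ)

/-- `lamL v = lamU (U v)`. [this work] -/
theorem lamL_eq (v : List ℕ) (q : P3) : lamL v q = lamU (U v) q := by
  unfold lamL lamU
  rw [indUP_eq]
  have h : ((P3list.filter fun p => memUP v p && TotDist p q).length : ℤ) = (nuCount (U v) q : ℤ) := by
    unfold nuCount
    congr 1
    rw [← List.toFinset_card_of_nodup (P3list_nodup.filter _)]
    congr 1
    ext p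
    simp only [List.mem_toFinset, List.mem_filter, mem_P3list, true_and, Bool.and_eq_true, mem_filter, mem_U_iff]
  rw [h]; norm_num

/-- Computable `Θ_{U v}`. [this work] -/
def thetaL (v : List ℕ) (q r : P3) : ℤ := if TotDist q r = true then indUP v q + indUP v r - indUP v (thirdPt q r) else 0

/-- `thetaL v = thetaVal (U v)`. [this work] -/
theorem thetaL_eq (v : List ℕ) (q r : P3) : thetaL v q r = thetaVal (U v) q r := by
  unfold thetaL thetaVal; rw [indUP_eq, indUP_eq, indUP_eq]

/-- Computable slice `β_{U v}(q,r)` in closed form (`sliceForm_eq`): `[q = r]·λ − Θ`. [this work] -/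
def ppL (v : List ℕ) (q r : P3) : ℤ := (if pidx q = pidx r then lamL v q else 0) - thetaL v q r

/-- `ppL v = sliceBeta (U v)`. [this work] -/
theorem ppL_eq (v : List ℕ) (q r : P3) : ppL v q r = sliceBeta (U v) q r := by
  unfold ppL sliceBeta
  rw [sliceForm_eq, lamL_eq, thetaL_eq]
  have h : (pidx q = pidx r) ↔ q = r := ⟨fun e => pidx_injective e, fun e => by rw [e]⟩
  unfold lamU
  simp only [h]

/-- Boolean test that `U v` is an up-set. [this work] -/
def upOK (v : List ℕ) : Bool :=
  P3list.all fun p => P3list.all fun q => (!decide (∀ a : Fin 3, p a ≤ q a)) || (!memUP v p) || memUP v q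

/-- `upOK v` certifies that `U v` is an up-set. [this work] -/
theorem isUpperSet_of_upOK {v : List ℕ} (h : upOK v = true) : IsUpperSet ((U v : Finset P3) : Set P3) := by
  intro p q hpq hp
  rw [Finset.mem_coe, mem_U_iff] at hp ⊢
  unfold upOK at h
  simp only [List.all_eq_true, Bool.or_eq_true] at h
  rcases h p (mem_P3list p) q (mem_P3list q) with h1 | h2
  · rcases h1 with h1 | h1
    · have : decide (∀ a : Fin 3, p a ≤ q a) = true := decide_eq_true (fun a => hpq a)
      rw [this] at h1; exact absurd h1 (by decide)
    · rw [hp] at h1; exact absurd h1 (by decide)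
  · exact h2

/-- Dual-cone generator by point indices: `lo = hi` the point evaluation at `pnt lo`, else the upward difference `[x = pnt hi] − [x = pnt lo]`.
[this work] -/
def gv (lo hi : ℕ) (x : P3) : ℤ :=
  if lo = hi then (if pidx x = lo then 1 else 0) else ((if pidx x = hi then 1 else 0) - (if pidx x = lo then 1 else 0))

/-- Validity of a generator: indices below `27` and `pnt lo ≤ pnt hi`. [this work] -/
def gvOK (lo hi : ℕ) : Bool := decide (lo < 27) && decide (hi < 27) && decide (∀ a : Fin 3, pnt lo a ≤ pnt hi a)

/-- **Valid generators are nonnegative on up-sets.** [this work] -/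
theorem sum_gv_nonneg {B : Finset P3} (hB : IsUpperSet (B : Set P3)) {lo hi : ℕ} (h : gvOK lo hi = true) : 0 ≤ ∑ x ∈ B, gv lo hi x := by
  unfold gvOK at h
  simp only [Bool.and_eq_true, decide_eq_true_eq] at h
  obtain ⟨⟨h1, h2⟩, hle⟩ := h
  unfold gv
  split_ifs with he
  · rw [sum_ite_pidx B h1]; unfold ind; split_ifs <;> norm_num
  · rw [Finset.sum_sub_distrib, sum_ite_pidx B h2, sum_ite_pidx B h1]
    unfold ind
    by_cases hlo : pnt lo ∈ B
    · have hhi : pnt hi ∈ B := hB (fun a => hle a) hlo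
      rw [if_pos hhi, if_pos hlo]; norm_num
    · rw [if_neg hlo]
      split_ifs <;> norm_num

/-! ### Atom matrices of a certificate entry `(c, kind, params)` -/

/-- `T`-matrix of an atom.  Kinds: `0` `[a,b]` Harris; `1` `v` good slot (`T`); `3` `[a,lo,hi]` B-side generator × C-side Kleitman column around
`pnt a`; `5` `[a,lo,hi]` B-side Kleitman column × C-side generator; `7` `[lo,hi,lo',hi']` generator product; even kinds `2,4,6,8` are the
`N`-versions (their `T`-matrix is `0`). [this work] -/
def atomT (v0 : List ℕ) (kd : ℕ) (ps : List ℕ) (q r : P3) : ℤ :=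
  if kd = 0 then (if pidx q = ps.getD 0 27 ∧ pidx r = ps.getD 1 27 then 1 else 0)
  else if kd = 1 then ppL ps q r
  else if kd = 3 then gv (ps.getD 1 0) (ps.getD 2 0) q * klC v0 (pnt (ps.getD 0 0)) r
  else if kd = 5 then klC v0 (pnt (ps.getD 0 0)) q * gv (ps.getD 1 0) (ps.getD 2 0) r
  else if kd = 7 then gv (ps.getD 0 0) (ps.getD 1 0) q * gv (ps.getD 2 0) (ps.getD 3 0) r
  else 0

/-- `N`-matrix of an atom. [this work] -/
def atomN (v0 : List ℕ) (kd : ℕ) (ps : List ℕ) (q r : P3) : ℤ :=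
  if kd = 0 then -(if pidx q = ps.getD 0 27 ∧ pidx r = ps.getD 1 27 then 1 else 0)
  else if kd = 2 then ppL ps q r
  else if kd = 4 then gv (ps.getD 1 0) (ps.getD 2 0) q * klC v0 (pnt (ps.getD 0 0)) r
  else if kd = 6 then klC v0 (pnt (ps.getD 0 0)) q * gv (ps.getD 1 0) (ps.getD 2 0) r
  else if kd = 8 then gv (ps.getD 0 0) (ps.getD 1 0) q * gv (ps.getD 2 0) (ps.getD 3 0) r
  else 0

/-- Parameter validity of an entry. [this work] -/
def entryOK (e : ℕ × ℕ × List ℕ) : Bool :=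
  if (e.2.1 = 1 ∨ e.2.1 = 2) then upOK e.2.2
  else if (e.2.1 = 3 ∨ e.2.1 = 4 ∨ e.2.1 = 5 ∨ e.2.1 = 6) then gvOK (e.2.2.getD 1 0) (e.2.2.getD 2 0)
  else if (e.2.1 = 7 ∨ e.2.1 = 8) then gvOK (e.2.2.getD 0 0) (e.2.2.getD 1 0) && gvOK (e.2.2.getD 2 0) (e.2.2.getD 3 0)
  else true

/-- Can the atom be nonzero in the row `q`?  (Used to prune the certificate row by row.) [this work] -/
def rowNZ (v0 : List ℕ) (kd : ℕ) (ps : List ℕ) (q : P3) : Bool :=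
  if kd = 0 then decide (pidx q = ps.getD 0 27)
  else if (kd = 1 ∨ kd = 2) then true
  else if (kd = 3 ∨ kd = 4) then !decide (gv (ps.getD 1 0) (ps.getD 2 0) q = 0)
  else if (kd = 5 ∨ kd = 6) then !decide (klC v0 (pnt (ps.getD 0 0)) q = 0)
  else if (kd = 7 ∨ kd = 8) then !decide (gv (ps.getD 0 0) (ps.getD 1 0) q = 0)
  else false

/-- An atom pruned from row `q` vanishes on that row. [this work] -/
theorem atom_row_zero {v0 : List ℕ} {kd : ℕ} {ps : List ℕ} {q : P3} (h : rowNZ v0 kd ps q = false) (r : P3) :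
    atomT v0 kd ps q r = 0 ∧ atomN v0 kd ps q r = 0 := by
  unfold rowNZ at h
  unfold atomT atomN
  by_cases h0 : kd = 0
  · subst h0
    simp only [if_true, decide_eq_false_iff_not] at h
    simp only [if_true]
    rw [if_neg (fun h' => h h'.1)]; simp
  simp only [if_neg h0] at h ⊢
  have h12 : ¬(kd = 1 ∨ kd = 2) := by
    intro h'; rw [if_pos h'] at h; exact Bool.noConfusion h
  have h1 : kd ≠ 1 := fun e => h12 (Or.inl e)
  have h2 : kd ≠ 2 := fun e => h12 (Or.inr e)
  simp only [if_neg h12] at h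
  simp only [if_neg h1, if_neg h2]
  by_cases h34 : kd = 3 ∨ kd = 4
  · rw [if_pos h34] at h
    simp only [Bool.not_eq_false', decide_eq_true_eq] at h
    rcases h34 with h3 | h4
    · subst h3
      simp only [if_true, show (3:ℕ) ≠ 4 by decide, show (3:ℕ) ≠ 6 by decide, show (3:ℕ) ≠ 8 by decide, if_false]
      rw [h]; simp
    · subst h4
      simp only [if_true, show (4:ℕ) ≠ 3 by decide, show (4:ℕ) ≠ 5 by decide, show (4:ℕ) ≠ 7 by decide, if_false]
      rw [h]; simp
  simp only [if_neg h34] at h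
  have h3 : kd ≠ 3 := fun e => h34 (Or.inl e)
  have h4 : kd ≠ 4 := fun e => h34 (Or.inr e)
  simp only [if_neg h3, if_neg h4]
  by_cases h56 : kd = 5 ∨ kd = 6
  · rw [if_pos h56] at h
    simp only [Bool.not_eq_false', decide_eq_true_eq] at h
    rcases h56 with h5 | h6
    · subst h5
      simp only [if_true, show (5:ℕ) ≠ 6 by decide, show (5:ℕ) ≠ 8 by decide, if_false]
      rw [h]; simp
    · subst h6
      simp only [if_true, show (6:ℕ) ≠ 5 by decide, show (6:ℕ) ≠ 7 by decide, if_false]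
      rw [h]; simp
  simp only [if_neg h56] at h
  have h5 : kd ≠ 5 := fun e => h56 (Or.inl e)
  have h6 : kd ≠ 6 := fun e => h56 (Or.inr e)
  simp only [if_neg h5, if_neg h6]
  by_cases h78 : kd = 7 ∨ kd = 8
  · rw [if_pos h78] at h
    simp only [Bool.not_eq_false', decide_eq_true_eq] at h
    rcases h78 with h7 | h8
    · subst h7
      simp only [if_true, show (7:ℕ) ≠ 8 by decide, if_false]
      rw [h]; simp
    · subst h8
      simp only [if_true, show (8:ℕ) ≠ 7 by decide, if_false]
      rw [h]; simp
  have h7 : kd ≠ 7 := fun e => h78 (Or.inl e)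
  have h8 : kd ≠ 8 := fun e => h78 (Or.inr e)
  simp only [if_neg h7, if_neg h8]
  simp

/-- Certified `T`-matrix: `Σ_{(c,kind,ps) ∈ cert} c · atomT`. [this work] -/
def certT (v0 : List ℕ) : List (ℕ × ℕ × List ℕ) → P3 → P3 → ℤ
  | [], _, _ => 0
  | e :: t, q, r => (e.1 : ℤ) * atomT v0 e.2.1 e.2.2 q r + certT v0 t q r

/-- Certified `N`-matrix. [this work] -/
def certN (v0 : List ℕ) : List (ℕ × ℕ × List ℕ) → P3 → P3 → ℤ
  | [], _, _ => 0
  | e :: t, q, r => (e.1 : ℤ) * atomN v0 e.2.1 e.2.2 q r + certN v0 t q r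

/-- Row pruning does not change the certified `T`-matrix on that row. [this work] -/
theorem certT_filter (v0 : List ℕ) (q r : P3) :
    ∀ cert : List (ℕ × ℕ × List ℕ), certT v0 (cert.filter fun e => rowNZ v0 e.2.1 e.2.2 q) q r = certT v0 cert q r
  | [] => by simp [certT]
  | e :: t => by
    cases hb : rowNZ v0 e.2.1 e.2.2 q with
    | true =>
      rw [List.filter_cons_of_pos (by exact hb)]
      show (e.1 : ℤ) * atomT v0 e.2.1 e.2.2 q r + certT v0 (t.filter fun e => rowNZ v0 e.2.1 e.2.2 q) q r = _
      rw [certT_filter v0 q r t]; rfl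
    | false =>
      rw [List.filter_cons_of_neg (by rw [hb]; exact Bool.false_ne_true), certT_filter v0 q r t]
      show certT v0 t q r = (e.1 : ℤ) * atomT v0 e.2.1 e.2.2 q r + certT v0 t q r
      rw [(atom_row_zero hb r).1]; ring

/-- Row pruning does not change the certified `N`-matrix on that row. [this work] -/
theorem certN_filter (v0 : List ℕ) (q r : P3) :
    ∀ cert : List (ℕ × ℕ × List ℕ), certN v0 (cert.filter fun e => rowNZ v0 e.2.1 e.2.2 q) q r = certN v0 cert q r
  | [] => by simp [certN]
  | e :: t => by
    cases hb : rowNZ v0 e.2.1 e.2.2 q with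
    | true =>
      rw [List.filter_cons_of_pos (by exact hb)]
      show (e.1 : ℤ) * atomN v0 e.2.1 e.2.2 q r + certN v0 (t.filter fun e => rowNZ v0 e.2.1 e.2.2 q) q r = _
      rw [certN_filter v0 q r t]; rfl
    | false =>
      rw [List.filter_cons_of_neg (by rw [hb]; exact Bool.false_ne_true), certN_filter v0 q r t]
      show certN v0 t q r = (e.1 : ℤ) * atomN v0 e.2.1 e.2.2 q r + certN v0 t q r
      rw [(atom_row_zero hb r).2]; ring

/-- Computable target matrices (`T`: diagonal `λ`; `N`: `−Θ`). [this work] -/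
def tgtTL (v0 : List ℕ) (q r : P3) : ℤ := if pidx q = pidx r then lamL v0 q else 0

/-- Computable `N`-target. [this work] -/
def tgtNL (v0 : List ℕ) (q r : P3) : ℤ := - thetaL v0 q r

/-- `tgtTL = tgtT`. [this work] -/
theorem tgtTL_eq (v0 : List ℕ) (q r : P3) : tgtTL v0 q r = tgtT (U v0) q r := by
  unfold tgtTL tgtT
  have h : (pidx q = pidx r) ↔ q = r := ⟨fun e => pidx_injective e, fun e => by rw [e]⟩
  simp only [h, lamL_eq]

/-- `tgtNL = tgtN`. [this work] -/
theorem tgtNL_eq (v0 : List ℕ) (q r : P3) : tgtNL v0 q r = tgtN (U v0) q r := by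
  unfold tgtNL tgtN; rw [thetaL_eq]

/-- **The cylinder-certificate checker** (Boolean, kernel-evaluable): `L > 0`, `U v0` is an up-set, every entry is valid, and for all cells
`q, r`: `L·tgtT = certT` and `L·tgtN = certN` (the certificate is pruned row by row before the inner loop, for speed). [this work] -/
def cylCheck (v0 : List ℕ) (L : ℕ) (cert : List (ℕ × ℕ × List ℕ)) : Bool :=
  decide (0 < L) && upOK v0 && (cert.all fun e => entryOK e) &&
    (P3list.all fun q =>
      let cq := cert.filter fun e => rowNZ v0 e.2.1 e.2.2 q
      P3list.all fun r =>
        ((L : ℤ) * tgtTL v0 q r == certT v0 cq q r) && ((L : ℤ) * tgtNL v0 q r == certN v0 cq q r))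

/-- What the checker checks. [this work] -/
theorem cylCheck_spec {v0 : List ℕ} {L : ℕ} {cert : List (ℕ × ℕ × List ℕ)} (h : cylCheck v0 L cert = true) :
    0 < L ∧ upOK v0 = true ∧ (∀ e ∈ cert, entryOK e = true) ∧
      ∀ q r : P3, (L : ℤ) * tgtT (U v0) q r = certT v0 cert q r ∧ (L : ℤ) * tgtN (U v0) q r = certN v0 cert q r := by
  unfold cylCheck at h
  simp only [Bool.and_eq_true, decide_eq_true_eq, List.all_eq_true, beq_iff_eq] at h
  obtain ⟨⟨⟨hL, hup⟩, hent⟩, hid⟩ := h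
  refine ⟨hL, hup, hent, fun q r => ?_⟩
  have h2 := hid q (mem_P3list q) r (mem_P3list r)
  rw [tgtTL_eq, tgtNL_eq, certT_filter, certN_filter] at h2
  exact h2

end Summit.CriticalPhenomena.PercolationContinuityZ3.Theorems.SahiGridPattern
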